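import Summits.QuantumFields.BalabanUV.T4Continuum.Support.OutputRateFunctionalTablesComplexPointwise
import Summits.QuantumFields.BalabanUV.T4Continuum.Support.OutputRateComplexSlice

/-!
# OutputRateComplexSliceEnd — THE END ON ROAD D WITH W1 DISPLAYED ON REAL POINTS ONLY: the two-constants junction
# (`OutputRateComplexSlice`) composed INTO the per-chart-point END (`OutputRateFunctionalTablesComplexPointwise`), with the
# two-chart shape (recursion chart `𝒰`, ambient slice chart `𝒱`) made explicit

Cell `pub-balaban`, unit `b2b-balaban-t4-ne5-p1` (row NE5 OWNER, gen 36; owner item «g36-a», ruling R51 (4), `HOME/CLAIMS.log` l.18137).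
Summits-side NEW WORK under the LEAN PLACEMENT RULE ([folklore] composition over ABSTRACT carriers and charts; nothing printed is
asserted; no `[cite:]`; no `Prop`-valued fact minted; 0 `def`).  HONEST FRAMING: rung (B)+1 of the FINITE-VOLUME T⁴ continuum programme —
NOT infinite volume, NOT a mass gap, NOT the Clay problem, NOT a proof of NE5 (NOT PRINTED; GAPS G-t4-U3-1), NOT a proof of NE2 or NE3.
HONEST DEPENDENCY (cell, verbatim): continuum YM on T⁴ ⇐ BetaPertH ∧ nine spine estimates (0/9 proved); BetaPertH ⇐ (D1) ∧ (D4) ∧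
CAP+tail; G-an2-4 gates asym, D1 and NE2/3/4.

WHY.  The per-chart-point END `OutputRateFunctionalTablesComplexPointwise.ne5_of_pointwiseSlots_reIm` (p227588) displays W1 as `hop`:
the two runs' operator rate AT EVERY POINT of the (complex, two-row) recursion chart `𝒰 × Fin 2`.  Rows NE2 ∕ NE3 type their rates on REAL
configurations.  `OutputRateComplexSlice.operatorRate_complex_of_realSlice_all` (p225933) produces the complex-point rate from the REAL-point
rate + holomorphy and a uniform bound along complex one-parameter slices (two-constants theorem), at the cost `(δ, θ) ↦ (δ^{1−λ}(2B)^{λ},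
θ^{1−λ})`, `λ = λ(r) = (2∕π)·arctan(2r∕(1−r²))` — but only at points of relative depth `≤ r < 1` of an AMBIENT chart in which the slices
live (a slice disc through a point leaves any depth-`r` set).  Hence the honest shape has TWO charts (R51 (4)): the recursion chart `𝒰` of
the END (every ∀-point binder of p227588 is consumed on ALL of it — at the instance: the subtype of depth-`r` charted points) and an ambient
slice chart `𝒱` (at the instance: the analyticity ball of the operator families, substrate `TowerData`∕`TwoRunChart`), related by a reading
map `e : 𝒰 × Fin 2 → 𝒱` through which the per-point slots read ambient operator families `oA`, `oB` (R49: at the instance the operators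
do not see the Re∕Im row — `e` factors through `Prod.fst`; the type allows row-aware readings).  This module composes the two theorems once, so that the END of Road D displays, in place of `hop`, EXACTLY: the real-point
rate `hreal` on a subset `real ⊆ 𝒱` (rows NE2 ∧ NE3's currency — (M1-real⁺) of `NE5-VERDICT.md` §11) and the slice letters `hslice` (printed
KIND: [Balaban1988RG2Cluster] (1.5) p. 3, p. 6 «analytic functions of the configurations … all the bounds above are uniform on the domain»;
asserted by nobody; substrate L-E12 `SubstrateChartRealSlicePair.hslice_sliceDisc₂_each` is an inhabitant of the seven-clause form).

WHAT ([folklore]; 0 def; the loss exponent `λ = λ(r) := (2∕π)·arctan(2r∕(1−r²))` is written INLINE in every statement, literally as in p225933).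
* `lossExp_nonneg` ∕ `lossExp_le_one` ∕ `self_le_rpow_one_sub` ∕ `degradedAmp_nonneg` ∕ `insRate_mono_rate`: `0 ≤ λ(r) ≤ 1`, `θ ≤ θ^{1−λ}`
  (`0 ≤ θ ≤ 1`), `0 ≤ δ^{1−λ}(2B)^{λ}`; the W4 insertion rate at rate `θ` implies it at the degraded rate; `small_degraded_of_small` (smallness at
  `θ` suffices for the displayed smallness at `θ^{1−λ}` — the consumer composes), `degradedRate_lt_one` (the output is an η-RATE `< 1`).
* `hop_of_realSlice` ∕ `hop_of_realSlice_each`: p227588's `hop` at the pair `(δ^{1−λ}(2B)^{λ}, θ^{1−λ})` from `e`, `hreal`, `hslice`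
  (difference form ∕ seven-clause form) — p225933 at `dom := Set.range e`.
* **`ne5_of_pointwiseSlots_reIm_realSlice`** — THE END: p227588's hypotheses VERBATIM except `hop` ↦ (`e`, readings `heA`∕`heB`, `hreal`,
  `hslice`), `hins` kept at the ORIGINAL rate `θ`, smallness displayed at the degraded rate `θ₁ = θ^{1−λ}` (WEAKER than at `θ`) ⟹
  `NE5 EA EB W κ θ₁ (4G(δ₁+δ′)(θ₁−ω)∕(θ₁−(1+4Gc)ω))`, `δ₁ = δ^{1−λ}(2B)^{λ}`; `…_each` (seven-clause slices).
ON THE READING MAP.  `e : 𝒰 × Fin 2 → 𝒱` is row-AWARE by type (the weaker-hypothesis form); R49's row-blind operators are the instance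
`e := e₀ ∘ Prod.fst` (leaf-01-g17 pre-read K2: the row-blind END is this END's specialisation).  `hr0 : 0 ≤ r` is displayed although
derivable from any slice (INFO-LOW K4).
WHAT IS NOT HERE.  No instance (`𝒰`, `𝒱`, `e`, `real`, the slices, the slots are the substrate's O1 ∕ Q-S16 ∕ L-E12 objects); no estimate
of [II]; rows NE2 ∕ NE3 are consumed on REAL points only and asserted by nobody.  0 sorry; axioms ⊆ {propext, Classical.choice, Quot.sound}.
-/

noncomputable section

open scoped BigOperators ENNReal
open Finset Function Metric Set Complex Real

namespace Summit.QuantumFields.BalabanUV.T4Continuum.OutputRateComplexSliceEnd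

open Literature.MathematicalPhysics.QuantumFieldTheory.Balaban1983to89
open Literature.MathematicalPhysics.QuantumFieldTheory.Balaban1983to89.T4OutputRate
open Literature.MathematicalPhysics.QuantumFieldTheory.Balaban1983to89.T4InputCauchyRateData
open Summit.QuantumFields.BalabanUV.T4Continuum.OutputRateFunctionalTables
open Summit.QuantumFields.BalabanUV.T4Continuum.OutputRateFunctionalTablesFamily
open Summit.QuantumFields.BalabanUV.T4Continuum.OutputRateFunctionalTablesPointwise
open Summit.QuantumFields.BalabanUV.T4Continuum.OutputRateFunctionalTablesComplex
open Summit.QuantumFields.BalabanUV.T4Continuum.OutputRateFunctionalTablesComplexPointwise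
open Summit.QuantumFields.BalabanUV.T4Continuum.OutputRateComplexSlice

variable {C : Carriers} {𝒰 𝒱 : Type} {Op Hist : Type*} [NormedAddCommGroup Op] [NormedSpace ℂ Op] [NormedAddCommGroup Hist]
  [NormedSpace ℂ Hist]

/-! ## §1 Arithmetic of the degraded rate -/

/-- [folklore] `0 ≤ λ(r)` for `0 ≤ r < 1`. -/
theorem lossExp_nonneg {r : ℝ} (hr0 : 0 ≤ r) (hr : r < 1) : 0 ≤ (2 / π * Real.arctan (2 * r / (1 - r ^ 2))) := by
  have h1 : 0 < 1 - r ^ 2 := by nlinarith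
  have : 0 ≤ Real.arctan (2 * r / (1 - r ^ 2)) := by
    rw [← Real.arctan_zero]
    exact Real.arctan_strictMono.monotone (div_nonneg (by linarith) h1.le)
  positivity

/-- [folklore] `λ(r) ≤ 1` (indeed `< 1`) for every `r`. -/
theorem lossExp_le_one (r : ℝ) : (2 / π * Real.arctan (2 * r / (1 - r ^ 2))) ≤ 1 := by
  have h := Real.arctan_lt_pi_div_two (2 * r / (1 - r ^ 2))
  have hπ : 0 < Real.pi := Real.pi_pos
  rw [div_mul_eq_mul_div, div_le_one hπ]
  linarith

/-- [folklore] The degraded rate dominates the rate: `θ ≤ θ^{1−λ}` for `0 ≤ θ ≤ 1`, `0 ≤ λ`. -/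
theorem self_le_rpow_one_sub {θ l : ℝ} (hθ : 0 ≤ θ) (hθ1 : θ ≤ 1) (hl : 0 ≤ l) : θ ≤ θ ^ (1 - l) :=
  Real.self_le_rpow_of_le_one hθ hθ1 (by linarith)

/-- [folklore] The degraded amplitude is nonnegative: `0 ≤ δ^{1−λ}·(2B)^{λ}`. -/
theorem degradedAmp_nonneg {δ B l : ℝ} (hδ : 0 ≤ δ) (hδB : δ ≤ 2 * B) : 0 ≤ δ ^ (1 - l) * (2 * B) ^ l :=
  mul_nonneg (Real.rpow_nonneg hδ _) (Real.rpow_nonneg (hδ.trans hδB) _)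

variable (P : PointwiseSlots C (𝒰 × Fin 2) Op Hist)

/-- [folklore] **W4 IS MONOTONE IN THE RATE**: the per-point insertion rate at rate `θ` implies it at any rate `θ′ ≥ θ ≥ 0` (`0 ≤ δ′`). -/
theorem insRate_mono_rate {W : Set (ℕ → ℝ)} {κ E₀ δ' θ θ' : ℝ} (hδ' : 0 ≤ δ') (hθ : 0 ≤ θ) (hθθ' : θ ≤ θ')
    (hins : ∀ k, ∀ g ∈ W, ∀ (t : C.Dom × (𝒰 × Fin 2) → ℝ), (∀ Y w, |t (Y, w)| ≤ E₀ * Real.exp (-(κ * C.d Y))) →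
      ∀ w, ‖P.insA g k t w - P.insB g k t w‖ ≤ δ' * θ ^ k * P.rHist k) :
    ∀ k, ∀ g ∈ W, ∀ (t : C.Dom × (𝒰 × Fin 2) → ℝ), (∀ Y w, |t (Y, w)| ≤ E₀ * Real.exp (-(κ * C.d Y))) →
      ∀ w, ‖P.insA g k t w - P.insB g k t w‖ ≤ δ' * θ' ^ k * P.rHist k := by
  intro k g hg t ht w
  refine (hins k g hg t ht w).trans ?_
  have : θ ^ k ≤ θ' ^ k := pow_le_pow_left₀ hθ hθθ' k
  have hr : 0 ≤ P.rHist k := (P.rHist_pos k).le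
  gcongr

/-! ## §2 `hop` of the per-point END from the real-point rate and the slice letters (two charts) -/

/-- [folklore] **W1 AT EVERY POINT OF THE RECURSION CHART FROM THE REAL-POINT RATE (difference form).**  Per-point slots `P` on the two-row
recursion chart `𝒰 × Fin 2` whose operator data READ ambient families `oA oB : (ℕ → ℝ) → ℕ → 𝒱 → Op` through `e : 𝒰 × Fin 2 → 𝒱`; the
real-point rate `δ·θ^k·rOp k` on `real ⊆ 𝒱`; through every read point `e w` a slice of relative depth `≤ r` with real diameter in `real`,
along which the DIFFERENCE is holomorphic and bounded by `2B·rOp k` ⟹ p227588's `hop` at `(δ^{1−λ}(2B)^{λ}, θ^{1−λ})`. -/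
theorem hop_of_realSlice {oA oB : (ℕ → ℝ) → ℕ → 𝒱 → Op} (e : 𝒰 × Fin 2 → 𝒱) {W : Set (ℕ → ℝ)} {real : Set 𝒱}
    {δ θ B r : ℝ} (hδ : 0 ≤ δ) (hδB : δ ≤ 2 * B) (hθ : 0 ≤ θ) (hθ1 : θ ≤ 1) (hr : r < 1)
    (heA : ∀ g ∈ W, ∀ k w, P.opA g k w = oA g k (e w)) (heB : ∀ g ∈ W, ∀ k w, P.opB g k w = oB g k (e w))
    (hreal : ∀ k, ∀ g ∈ W, ∀ v ∈ real, ‖oA g k v - oB g k v‖ ≤ δ * θ ^ k * P.rOp k)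
    (hslice : ∀ k, ∀ g ∈ W, ∀ w : 𝒰 × Fin 2, ∃ γ : ℂ → 𝒱, ∃ z₀ : ℂ, ‖z₀‖ ≤ r ∧ γ z₀ = e w ∧ (∀ x : ℝ, |x| < 1 → γ x ∈ real) ∧
      DiffContOnCl ℂ (fun z => oA g k (γ z) - oB g k (γ z)) (ball 0 1) ∧
        ∀ z : ℂ, ‖z‖ ≤ 1 → ‖oA g k (γ z) - oB g k (γ z)‖ ≤ 2 * B * P.rOp k) :
    ∀ k, ∀ g ∈ W, ∀ w : 𝒰 × Fin 2,
      ‖P.opA g k w - P.opB g k w‖ ≤ (δ ^ (1 - (2 / π * Real.arctan (2 * r / (1 - r ^ 2)))) * (2 * B) ^ (2 / π * Real.arctan (2 * r / (1 - r ^ 2)))) * (θ ^ (1 - (2 / π * Real.arctan (2 * r / (1 - r ^ 2))))) ^ k * P.rOp k := by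
  have key := operatorRate_complex_of_realSlice_all (opA := oA) (opB := oB) (W := W) (real := real) (dom := Set.range e)
    (rOp := P.rOp) hδ hδB hθ hθ1 (fun k => (P.rOp_pos k).le) hr hreal (fun k g hg v hv => by
      obtain ⟨w, rfl⟩ := hv
      exact hslice k g hg w)
  intro k g hg w
  rw [heA g hg k w, heB g hg k w]
  exact key k g hg (e w) (Set.mem_range_self w)

/-- [folklore] **The same with the two families' slices hypothesised SEPARATELY** (seven clauses: each family holomorphic in the open disc,
continuous on the closed disc and bounded there by `B·rOp k` — the shape substrate L-E12 `hslice_sliceDisc₂_each` inhabits). -/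
theorem hop_of_realSlice_each {oA oB : (ℕ → ℝ) → ℕ → 𝒱 → Op} (e : 𝒰 × Fin 2 → 𝒱) {W : Set (ℕ → ℝ)} {real : Set 𝒱}
    {δ θ B r : ℝ} (hδ : 0 ≤ δ) (hδB : δ ≤ 2 * B) (hθ : 0 ≤ θ) (hθ1 : θ ≤ 1) (hr : r < 1)
    (heA : ∀ g ∈ W, ∀ k w, P.opA g k w = oA g k (e w)) (heB : ∀ g ∈ W, ∀ k w, P.opB g k w = oB g k (e w))
    (hreal : ∀ k, ∀ g ∈ W, ∀ v ∈ real, ‖oA g k v - oB g k v‖ ≤ δ * θ ^ k * P.rOp k)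
    (hslice : ∀ k, ∀ g ∈ W, ∀ w : 𝒰 × Fin 2, ∃ γ : ℂ → 𝒱, ∃ z₀ : ℂ, ‖z₀‖ ≤ r ∧ γ z₀ = e w ∧ (∀ x : ℝ, |x| < 1 → γ x ∈ real) ∧
      DiffContOnCl ℂ (fun z => oA g k (γ z)) (ball 0 1) ∧ DiffContOnCl ℂ (fun z => oB g k (γ z)) (ball 0 1) ∧
        (∀ z : ℂ, ‖z‖ ≤ 1 → ‖oA g k (γ z)‖ ≤ B * P.rOp k) ∧ ∀ z : ℂ, ‖z‖ ≤ 1 → ‖oB g k (γ z)‖ ≤ B * P.rOp k) :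
    ∀ k, ∀ g ∈ W, ∀ w : 𝒰 × Fin 2,
      ‖P.opA g k w - P.opB g k w‖ ≤ (δ ^ (1 - (2 / π * Real.arctan (2 * r / (1 - r ^ 2)))) * (2 * B) ^ (2 / π * Real.arctan (2 * r / (1 - r ^ 2)))) * (θ ^ (1 - (2 / π * Real.arctan (2 * r / (1 - r ^ 2))))) ^ k * P.rOp k := by
  refine hop_of_realSlice P e hδ hδB hθ hθ1 hr heA heB hreal fun k g hg w => ?_
  obtain ⟨γ, z₀, hz₀, hγw, hγreal, hA, hB, hbA, hbB⟩ := hslice k g hg w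
  refine ⟨γ, z₀, hz₀, hγw, hγreal, hA.sub hB, fun z hz => ?_⟩
  calc ‖oA g k (γ z) - oB g k (γ z)‖ ≤ ‖oA g k (γ z)‖ + ‖oB g k (γ z)‖ := norm_sub_le _ _
    _ ≤ B * P.rOp k + B * P.rOp k := add_le_add (hbA z hz) (hbB z hz)
    _ = 2 * B * P.rOp k := by ring

/-! ## §3 THE END on Road D with W1 displayed on real points only -/

/-- [folklore] **END — `T4OutputRate.NE5 EA EB` OVER THE ORIGINAL CARRIERS, W1 ON REAL POINTS.**  The hypotheses of
`OutputRateFunctionalTablesComplexPointwise.ne5_of_pointwiseSlots_reIm` VERBATIM — complex representation identities `hrA`∕`hrB` at every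
point of the recursion chart (MI-R), the inserted families of record bounded over the chart, admissibility, the output envelope `henv` (W2),
the complex-domain decay bounds `hdA`∕`hdB` (L05∕L06), the insertion rate `hins` (W4, at the ORIGINAL rate `θ`), the damped-Lipschitz binder
`hdamp` (W3), the real section `ι` — EXCEPT that W1 is displayed as: ambient operator families `oA`, `oB` on the slice chart `𝒱` READ by the
slots through `e` (`heA`∕`heB`), their REAL-POINT rate `hreal` on `real ⊆ 𝒱` (rows NE2 ∧ NE3's currency), and the slice letters `hslice`
(relative depth `≤ r`, real diameter in `real`, the difference holomorphic and bounded by `2B·rOp k`); smallness displayed at the DEGRADED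
rate `θ₁ = θ^{1−λ(r)}`.  Conclusion: `NE5 EA EB W κ θ₁ (4G(δ₁+δ′)(θ₁−ω)∕(θ₁−(1+4Gc)ω))`, `δ₁ = δ^{1−λ}(2B)^{λ}`. -/
theorem ne5_of_pointwiseSlots_reIm_realSlice [Nonempty 𝒰] {ℰA ℰB : (ℕ → ℝ) → 𝒰 → C.Dom → ℂ} {EA : Functional C C.BgA}
    {EB : Functional C C.BgB} {W : Set (ℕ → ℝ)} {κ G E₀ δ δ' θ c ω B r : ℝ}
    {oA oB : (ℕ → ℝ) → ℕ → 𝒱 → Op} (e : 𝒰 × Fin 2 → 𝒱) {real : Set 𝒱}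
    (hbdA : ∀ g ∈ W, ∀ k, BddAbove (Set.range fun w => ‖P.insA g k (tableA (reImTab (C := C) ℰA) g PUnit.unit) w‖))
    (hbdB : ∀ g ∈ W, ∀ k, BddAbove (Set.range fun w => ‖P.insB g k (tableB (reImTab (C := C) ℰB) g PUnit.unit) w‖))
    (hrA : ∀ g ∈ W, ∀ (X : C.Dom) (u : 𝒰) (i : Fin 2), ℰA g u X =
      P.Out (C.scale X) (P.opA g (C.scale X) (u, i)) (P.insA g (C.scale X) (tableA (reImTab (C := C) ℰA) g PUnit.unit) (u, i)) X)
    (hrB : ∀ g ∈ W, ∀ (X : C.Dom) (u : 𝒰) (i : Fin 2), ℰB g u X =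
      P.Out (C.scale X) (P.opB g (C.scale X) (u, i)) (P.insB g (C.scale X) (tableB (reImTab (C := C) ℰB) g PUnit.unit) (u, i)) X)
    (hbase : ∀ k, ∀ g ∈ W, ∀ w, (P.opB g k w, P.insB g k (tableB (reImTab (C := C) ℰB) g PUnit.unit) w) ∈ P.Base k g w)
    (henv : ∀ k, ∀ g ∈ W, ∀ w, ∀ q ∈ P.Base k g w, ∀ X : C.Dom, C.scale X = k →
      DifferentiableOn ℂ (fun z : Op × Hist => P.Out k z.1 z.2 X) (closedBall q.1 (P.rOp k) ×ˢ closedBall q.2 (P.rHist k)) ∧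
        ∀ z ∈ closedBall q.1 (P.rOp k) ×ˢ closedBall q.2 (P.rHist k), ‖P.Out k z.1 z.2 X‖ ≤ G * Real.exp (-(κ * C.d X)))
    (hdA : ∀ g ∈ W, ∀ (u : 𝒰) (X : C.Dom), ‖ℰA g u X‖ ≤ G * Real.exp (-(κ * C.d X)))
    (hdB : ∀ g ∈ W, ∀ (u : 𝒰) (X : C.Dom), ‖ℰB g u X‖ ≤ E₀ * Real.exp (-(κ * C.d X))) (hE₀ : E₀ ≤ G)
    -- W1 on REAL points + the slice letters (in place of p227588's `hop`):
    (heA : ∀ g ∈ W, ∀ k w, P.opA g k w = oA g k (e w)) (heB : ∀ g ∈ W, ∀ k w, P.opB g k w = oB g k (e w))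
    (hreal : ∀ k, ∀ g ∈ W, ∀ v ∈ real, ‖oA g k v - oB g k v‖ ≤ δ * θ ^ k * P.rOp k)
    (hslice : ∀ k, ∀ g ∈ W, ∀ w : 𝒰 × Fin 2, ∃ γ : ℂ → 𝒱, ∃ z₀ : ℂ, ‖z₀‖ ≤ r ∧ γ z₀ = e w ∧ (∀ x : ℝ, |x| < 1 → γ x ∈ real) ∧
      DiffContOnCl ℂ (fun z => oA g k (γ z) - oB g k (γ z)) (ball 0 1) ∧
        ∀ z : ℂ, ‖z‖ ≤ 1 → ‖oA g k (γ z) - oB g k (γ z)‖ ≤ 2 * B * P.rOp k)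
    (hδ0 : 0 ≤ δ) (hδB : δ ≤ 2 * B) (hθ0 : 0 ≤ θ) (hθ1 : θ ≤ 1) (hr0 : 0 ≤ r) (hr : r < 1)
    -- W4, W3 and the arithmetic, as in p227588 (W4 at the ORIGINAL rate `θ`):
    (hins : ∀ k, ∀ g ∈ W, ∀ (t : C.Dom × (𝒰 × Fin 2) → ℝ), (∀ Y w, |t (Y, w)| ≤ E₀ * Real.exp (-(κ * C.d Y))) →
      ∀ w, ‖P.insA g k t w - P.insB g k t w‖ ≤ δ' * θ ^ k * P.rHist k)
    (hdamp : ∀ k, ∀ g ∈ W, ∀ (t t' : C.Dom × (𝒰 × Fin 2) → ℝ) (D : ℕ → ℝ), (∀ j < k, 0 ≤ D j) →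
      (∀ Y, C.scale Y < k → ∀ w, |t (Y, w) - t' (Y, w)| ≤ D (C.scale Y) * Real.exp (-(κ * C.d Y))) →
        ∀ w, ‖P.insA g k t w - P.insA g k t' w‖ ≤ P.rHist k * (c * ∑ j ∈ range k, ω ^ (k - j) * D j))
    (hG : 0 ≤ G) (hδ' : 0 ≤ δ') (hc : 0 ≤ c) (hω : 0 ≤ ω) (hsmall : (1 + 4 * G * c) * ω < θ ^ (1 - (2 / π * Real.arctan (2 * r / (1 - r ^ 2)))))
    (ι : C.BgB → 𝒰) (hιA : ∀ g ∈ W, ∀ (U : C.BgB) (X : C.Dom), EA g (C.transport U) X = (ℰA g (ι U) X).re)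
    (hιB : ∀ g ∈ W, ∀ (U : C.BgB) (X : C.Dom), EB g U X = (ℰB g (ι U) X).re) :
    NE5 EA EB W κ (θ ^ (1 - (2 / π * Real.arctan (2 * r / (1 - r ^ 2)))))
      (4 * G * (δ ^ (1 - (2 / π * Real.arctan (2 * r / (1 - r ^ 2)))) * (2 * B) ^ (2 / π * Real.arctan (2 * r / (1 - r ^ 2))) + δ') * (θ ^ (1 - (2 / π * Real.arctan (2 * r / (1 - r ^ 2)))) - ω) /
        (θ ^ (1 - (2 / π * Real.arctan (2 * r / (1 - r ^ 2)))) - (1 + 4 * G * c) * ω)) :=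
  ne5_of_pointwiseSlots_reIm P hbdA hbdB hrA hrB hbase henv hdA hdB hE₀
    (hop_of_realSlice P e hδ0 hδB hθ0 hθ1 hr heA heB hreal hslice)
    (insRate_mono_rate P hδ' hθ0 (self_le_rpow_one_sub hθ0 hθ1 (lossExp_nonneg hr0 hr)) hins) hdamp hG
    (add_nonneg (degradedAmp_nonneg hδ0 hδB) hδ') hc hω hsmall ι hιA hιB

/-- [folklore] **THE END, seven-clause slices** (each family's slice holomorphy and bound `B·rOp k` hypothesised separately — substrate L-E12's shape). -/
theorem ne5_of_pointwiseSlots_reIm_realSlice_each [Nonempty 𝒰] {ℰA ℰB : (ℕ → ℝ) → 𝒰 → C.Dom → ℂ} {EA : Functional C C.BgA}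
    {EB : Functional C C.BgB} {W : Set (ℕ → ℝ)} {κ G E₀ δ δ' θ c ω B r : ℝ}
    {oA oB : (ℕ → ℝ) → ℕ → 𝒱 → Op} (e : 𝒰 × Fin 2 → 𝒱) {real : Set 𝒱}
    (hbdA : ∀ g ∈ W, ∀ k, BddAbove (Set.range fun w => ‖P.insA g k (tableA (reImTab (C := C) ℰA) g PUnit.unit) w‖))
    (hbdB : ∀ g ∈ W, ∀ k, BddAbove (Set.range fun w => ‖P.insB g k (tableB (reImTab (C := C) ℰB) g PUnit.unit) w‖))
    (hrA : ∀ g ∈ W, ∀ (X : C.Dom) (u : 𝒰) (i : Fin 2), ℰA g u X =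
      P.Out (C.scale X) (P.opA g (C.scale X) (u, i)) (P.insA g (C.scale X) (tableA (reImTab (C := C) ℰA) g PUnit.unit) (u, i)) X)
    (hrB : ∀ g ∈ W, ∀ (X : C.Dom) (u : 𝒰) (i : Fin 2), ℰB g u X =
      P.Out (C.scale X) (P.opB g (C.scale X) (u, i)) (P.insB g (C.scale X) (tableB (reImTab (C := C) ℰB) g PUnit.unit) (u, i)) X)
    (hbase : ∀ k, ∀ g ∈ W, ∀ w, (P.opB g k w, P.insB g k (tableB (reImTab (C := C) ℰB) g PUnit.unit) w) ∈ P.Base k g w)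
    (henv : ∀ k, ∀ g ∈ W, ∀ w, ∀ q ∈ P.Base k g w, ∀ X : C.Dom, C.scale X = k →
      DifferentiableOn ℂ (fun z : Op × Hist => P.Out k z.1 z.2 X) (closedBall q.1 (P.rOp k) ×ˢ closedBall q.2 (P.rHist k)) ∧
        ∀ z ∈ closedBall q.1 (P.rOp k) ×ˢ closedBall q.2 (P.rHist k), ‖P.Out k z.1 z.2 X‖ ≤ G * Real.exp (-(κ * C.d X)))
    (hdA : ∀ g ∈ W, ∀ (u : 𝒰) (X : C.Dom), ‖ℰA g u X‖ ≤ G * Real.exp (-(κ * C.d X)))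
    (hdB : ∀ g ∈ W, ∀ (u : 𝒰) (X : C.Dom), ‖ℰB g u X‖ ≤ E₀ * Real.exp (-(κ * C.d X))) (hE₀ : E₀ ≤ G)
    (heA : ∀ g ∈ W, ∀ k w, P.opA g k w = oA g k (e w)) (heB : ∀ g ∈ W, ∀ k w, P.opB g k w = oB g k (e w))
    (hreal : ∀ k, ∀ g ∈ W, ∀ v ∈ real, ‖oA g k v - oB g k v‖ ≤ δ * θ ^ k * P.rOp k)
    (hslice : ∀ k, ∀ g ∈ W, ∀ w : 𝒰 × Fin 2, ∃ γ : ℂ → 𝒱, ∃ z₀ : ℂ, ‖z₀‖ ≤ r ∧ γ z₀ = e w ∧ (∀ x : ℝ, |x| < 1 → γ x ∈ real) ∧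
      DiffContOnCl ℂ (fun z => oA g k (γ z)) (ball 0 1) ∧ DiffContOnCl ℂ (fun z => oB g k (γ z)) (ball 0 1) ∧
        (∀ z : ℂ, ‖z‖ ≤ 1 → ‖oA g k (γ z)‖ ≤ B * P.rOp k) ∧ ∀ z : ℂ, ‖z‖ ≤ 1 → ‖oB g k (γ z)‖ ≤ B * P.rOp k)
    (hδ0 : 0 ≤ δ) (hδB : δ ≤ 2 * B) (hθ0 : 0 ≤ θ) (hθ1 : θ ≤ 1) (hr0 : 0 ≤ r) (hr : r < 1)
    (hins : ∀ k, ∀ g ∈ W, ∀ (t : C.Dom × (𝒰 × Fin 2) → ℝ), (∀ Y w, |t (Y, w)| ≤ E₀ * Real.exp (-(κ * C.d Y))) →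
      ∀ w, ‖P.insA g k t w - P.insB g k t w‖ ≤ δ' * θ ^ k * P.rHist k)
    (hdamp : ∀ k, ∀ g ∈ W, ∀ (t t' : C.Dom × (𝒰 × Fin 2) → ℝ) (D : ℕ → ℝ), (∀ j < k, 0 ≤ D j) →
      (∀ Y, C.scale Y < k → ∀ w, |t (Y, w) - t' (Y, w)| ≤ D (C.scale Y) * Real.exp (-(κ * C.d Y))) →
        ∀ w, ‖P.insA g k t w - P.insA g k t' w‖ ≤ P.rHist k * (c * ∑ j ∈ range k, ω ^ (k - j) * D j))
    (hG : 0 ≤ G) (hδ' : 0 ≤ δ') (hc : 0 ≤ c) (hω : 0 ≤ ω) (hsmall : (1 + 4 * G * c) * ω < θ ^ (1 - (2 / π * Real.arctan (2 * r / (1 - r ^ 2)))))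
    (ι : C.BgB → 𝒰) (hιA : ∀ g ∈ W, ∀ (U : C.BgB) (X : C.Dom), EA g (C.transport U) X = (ℰA g (ι U) X).re)
    (hιB : ∀ g ∈ W, ∀ (U : C.BgB) (X : C.Dom), EB g U X = (ℰB g (ι U) X).re) :
    NE5 EA EB W κ (θ ^ (1 - (2 / π * Real.arctan (2 * r / (1 - r ^ 2)))))
      (4 * G * (δ ^ (1 - (2 / π * Real.arctan (2 * r / (1 - r ^ 2)))) * (2 * B) ^ (2 / π * Real.arctan (2 * r / (1 - r ^ 2))) + δ') * (θ ^ (1 - (2 / π * Real.arctan (2 * r / (1 - r ^ 2)))) - ω) /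
        (θ ^ (1 - (2 / π * Real.arctan (2 * r / (1 - r ^ 2)))) - (1 + 4 * G * c) * ω)) :=
  ne5_of_pointwiseSlots_reIm P hbdA hbdB hrA hrB hbase henv hdA hdB hE₀
    (hop_of_realSlice_each P e hδ0 hδB hθ0 hθ1 hr heA heB hreal hslice)
    (insRate_mono_rate P hδ' hθ0 (self_le_rpow_one_sub hθ0 hθ1 (lossExp_nonneg hr0 hr)) hins) hdamp hG
    (add_nonneg (degradedAmp_nonneg hδ0 hδB) hδ') hc hω hsmall ι hιA hιB

/-- [folklore] **Smallness at the ORIGINAL rate suffices** (it is STRONGER): `(1+4Gc)ω < θ ≤ θ^{1−λ}`. -/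
theorem small_degraded_of_small {G c ω θ r : ℝ} (hθ0 : 0 ≤ θ) (hθ1 : θ ≤ 1) (hr0 : 0 ≤ r) (hr : r < 1)
    (hsmall : (1 + 4 * G * c) * ω < θ) : (1 + 4 * G * c) * ω < θ ^ (1 - (2 / π * Real.arctan (2 * r / (1 - r ^ 2)))) :=
  hsmall.trans_le (self_le_rpow_one_sub hθ0 hθ1 (lossExp_nonneg hr0 hr))

/-- [folklore] **The degraded rate is a rate**: `θ^{1−λ(r)} < 1` for `0 ≤ θ < 1`, `r < 1` (so the END's conclusion is an η-RATE, consumable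
by rows NE7 ∕ NE7b's Cauchy sum at any rate `< 1`). -/
theorem degradedRate_lt_one {θ r : ℝ} (hθ0 : 0 ≤ θ) (hθ1 : θ < 1) : θ ^ (1 - (2 / π * Real.arctan (2 * r / (1 - r ^ 2)))) < 1 :=
  rate_rpow_lt_one hθ0 hθ1 (by
    have h := Real.arctan_lt_pi_div_two (2 * r / (1 - r ^ 2))
    have hπ : 0 < Real.pi := Real.pi_pos
    rw [div_mul_eq_mul_div, div_lt_one hπ]
    linarith)

end Summit.QuantumFields.BalabanUV.T4Continuum.OutputRateComplexSliceEnd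

end
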